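import Summits.Ventures.CertifiedQuantumChemistry.Rows.SectorRows
import Summits.Ventures.CertifiedQuantumChemistry.Rows.SweepContraction
import Summits.Ventures.CertifiedQuantumChemistry.Rows.JordanWignerWords
import HarnessLib

/-!
# Ventures/CertifiedQuantumChemistry — Rows/MPSUpperBound.lean: the MPS level's kernel chain — a matrix-product state,
# an MPO representing the Hamiltonian, the §1.2 sector labels, enclosures of the two sweeps and the value rule give the
# typer's `UpperCertificate` / `UpperRow` (FORMAT-qcmps0 §0–§4 composed in the kernel, every `k`, every bond dimension)

HONEST FRAMING (verbatim): certified bounds for a stated model Hamiltonian in a stated basis; not a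
claim about the real molecule beyond that model.

var-2 (gen 10), zero compute, PROVED glue only (0 sorry, no definition, no claim node; nothing here asserts a bound about
any model). The cell's MPS upper certificates (`qc-upper-v0` with a `qc-mps-v0` state, FORMAT-qcmps0; rows #114 / #127 /
#130 and the gated R2B-U / R3A-U rows) enter `Certificates/` as `UpperCertificate` CLAIM NODES. Their mathematics was put
in the tree piecewise — `Rows/SweepContraction.lean` (a sweep IS the configuration sum; chain reversal; the value rule),
`Rows/SweepErrorBudget.lean` (the floating-point / interval evaluation of a sweep stays within its budget),
`Rows/JordanWignerWords.lean` (JW letters, `H_F` as a finite sum of words, MPO = path sum, the sector rule for words) —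
but no theorem yet said that these pieces, applied to the numbers a reader checks, produce the typer's predicate
`UpperCertificate F a b hi := ∃ ψ ≠ 0, IsInSector a b ψ ∧ Re⟨ψ, H_F ψ⟩ ≤ hi·⟨ψ, ψ⟩` (`Rows/SectorRows.lean`). This file
is that composition (the analogue, on the upper side, of the typer's `Rows/SectorBlockLowerBound.lean` for the CHOL
class and of `Rows/CIUpperBound.lean` for integer CI vectors): the WITNESS is the MPS vector itself, read into the
tree's Fock space through the site-major Jordan–Wigner identification `JordanWigner.toSpinVec`
(`Literature/…/QuantumLattice/HubbardJordanWigner`, local basis `|0⟩,|α⟩,|β⟩,|αβ⟩` = FORMAT-qcmps0 §1's codes), and every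
hypothesis is one of the reader's checks:

* the STATE (FORMAT-qcmps0 §1): site tensors `A i s : Matrix n n ℝ` over one bond index type `n` (the file's
  block-sparse rectangular dyadic blocks, zero-padded — as in `Rows/SweepContraction.lean`), boundary vectors `u`, `w`
  (`D₀ = D_k = 1`: `u = w = e₀`), amplitude `ψ(κ) = u ⬝ (A_0^{κ₀} ⋯ A_{k-1}^{κ_{k-1}}) w` on `κ : Fin k → Fin 4` ("plain
  matrix products, no extra signs", §1.2);
* the SECTOR (§1.2 "SECTOR RULE"): `hsec` — the amplitude vanishes off the configurations with `a` up / `b` down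
  electrons; **`mps_support_of_charges`** derives it from the file's bond labels exactly as the readers check them
  (`qr = ql + occ(s)` on every non-zero block entry, bond `0 = {(0,0)}`, bond `k = {(na,nb)}`), by
  `ofFn_prod_apply_eq_zero_of_charge_ne`; `card_upPart_config` / `card_downPart_config` count `#α`, `#β` site by site;
* the OPERATOR (§3): `hO` — the MPO's word products `(O_0[κ₀,κ'₀] ⋯ O_{k-1}[κ_{k-1},κ'_{k-1}])[START, END]` ARE the
  configuration matrix elements of `H` in the product basis (`toSpin H`); **`toSpin_eq_of_wordProducts_of_eq_sum_paths`**
  reduces it to the path-sum form "`H` = Σ over accepting paths of ⨂ edge letters" in which an automaton enumerating the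
  term list `Σ_t c_t ⨂_j w^t_j = H_F` is stated (`Rows/JordanWignerWords.lean`);
* the VALUES (§4): **`star_dotProduct_self_eq_gram_sweep`** — the trivial-MPO sweep `G_{j+1} = Σ_s (A_j^s)ᵀ G_j A_j^s`,
  `G_0 = u uᵀ`, gives `⟨ψ, ψ⟩ = w ⬝ G_k w`; **`star_dotProduct_mulVec_eq_sweep`** — the environment recursion
  `L_{j+1}[y] = Σ_x Σ_{ss'} O_j[x,y][s,s'] • (A_j^s)ᵀ L_j[x] A_j^{s'}`, `L_0 = u uᵀ` on START, gives `⟨ψ, Hψ⟩ = w ⬝ L_k[END] w`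
  — EXACT identities for the exact recursions (whose floating-point / interval evaluations `Rows/SweepErrorBudget.lean`
  controls); **`dotProduct_revSweep_mulVec_eq`** — the right-to-left sweep of the code (`reverse_problem`: mirrored
  chain, transposed tensors, boundary data exchanged) computes the SAME configuration sum, so a right-canonical
  (block2 `KRR…R`) state's certificate feeds the same theorem;
* the BOUND (§4 "BOUND" = FORMAT-qcu0 §3): enclosures `hhi ≥ ⟨ψ,Hψ⟩`, `0 < nlo ≤ ⟨ψ,ψ⟩ ≤ nhi` and an issued
  `hi ≥ max (hhi/nlo) (hhi/nhi)` (`le_max_div_mul_of_enclosure`).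

ENTRY POINTS: **`upperCertificate_of_mps_configSums`** (direction-free: enclosures of the two configuration sums) and
**`upperCertificate_of_mps_sweeps`** (enclosures of the left-to-right swept numbers) give `UpperCertificate F a b hi` for
ANY model `F : Model k` (no symmetry needed — the predicate is variational data); the END FORM
**`upperRow_of_mps_charges_sweeps`** (bond labels + MPO + sweeps + value rule ⇒ `UpperRow F a b hi`) adds `F.IsSymmetric`
for Rayleigh–Ritz (`upperRow_of_certificate`); **`sectorGroundEnergy_le_of_mps_configSums`** is the same bound for any
Hermitian `H` an MPO represents (e.g. the Hubbard test vectors' MPS states). The generic lemmas of the first section hold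
for real amplitude functions on any finite ordered site set `Λ`.

What is NOT claimed: no MPO automaton is constructed here and `hO` is not discharged for any model (the accepting-paths
bookkeeping and the `> 2·10⁴`-literal state blocks stay instance data with the readers — `tests/test_mpo.py`, lineages
A1 / B2 / B3 / B′ — exactly as for every certificate class of the cell); no floating-point statement; no row; nothing is
instantiated (`Rows/CIUpperBound.lean` is the finite-support witness class with kernel-evaluated rationals; here the
witness is an MPS of arbitrary bond dimension and the Rayleigh data are swept). References: S. Östlund, S. Rommer, Phys.
Rev. Lett. 75 (1995) 3537 (matrix-product variational states); U. Schollwöck, Ann. Phys. 326 (2011) 96, §4.2 / §6 (MPO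
expectation values by environments); G. K.-L. Chan, A. Keselman, N. Nakatani, Z. Li, S. R. White, J. Chem. Phys. 145 (2016)
014102 (the quantum-chemistry Hamiltonian as an MPO); H. Tasaki (2020) §2.2 (Rayleigh–Ritz, the tree's
`sectorGroundEnergy_le_of_rayleigh`); FORMAT-qcmps0 §0–§4, FORMAT-qcu0 §0/§3 (HOME `pub-qchem-var2/`, `pub-qchem-var/`);
qcmps `mps_io.py` (`QCMPS.check`), `mpo.py`, `contract*.py`, `certify.py`.
-/

noncomputable section

namespace Summit.Ventures.CertifiedQuantumChemistry

open Matrix Finset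
open Literature.MathematicalPhysics.QuantumLattice
open Literature.MathematicalPhysics.QuantumLattice.JordanWigner
open Literature.MathematicalPhysics.QuantumChemistry

/-! ## Real amplitude functions on configurations, read as Fock vectors -/

section RealAmplitude

variable {Λ : Type*} [LinearOrder Λ] [Fintype Λ]

/-- **Norm.** The Fock vector with real configuration amplitudes `φ` (`ψ(config κ) = φ κ`, the tree's site-major
Jordan–Wigner identification `toSpinVec`) has `⟨ψ, ψ⟩ = Σ_κ φ(κ)²`. -/
theorem star_dotProduct_toSpinVec_symm_ofReal (φ : TensorIndex Λ 4 → ℝ) :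
    star (toSpinVec.symm fun κ => (φ κ : ℂ)) ⬝ᵥ (toSpinVec.symm fun κ => (φ κ : ℂ)) =
      ((∑ κ, φ κ * φ κ : ℝ) : ℂ) := by
  rw [← star_toSpinVec_dotProduct, LinearEquiv.apply_symm_apply]
  simp only [dotProduct, Pi.star_apply, Complex.star_def, Complex.conj_ofReal, Complex.ofReal_sum,
    Complex.ofReal_mul]

/-- **Expectation.** If the operator `H`, read in the product basis (`toSpin`), has the REAL configuration matrix
elements `M κ κ'`, then the Fock vector with real amplitudes `φ` has `⟨ψ, H ψ⟩ = Σ_{κ κ'} φ(κ) M(κ,κ') φ(κ')`. -/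
theorem star_dotProduct_mulVec_toSpinVec_symm_ofReal (H : Matrix (Finset (Orb Λ)) (Finset (Orb Λ)) ℂ)
    (M : TensorIndex Λ 4 → TensorIndex Λ 4 → ℝ) (hM : toSpin H = Matrix.of fun κ κ' => ((M κ κ' : ℝ) : ℂ))
    (φ : TensorIndex Λ 4 → ℝ) :
    star (toSpinVec.symm fun κ => (φ κ : ℂ)) ⬝ᵥ H *ᵥ (toSpinVec.symm fun κ => (φ κ : ℂ)) =
      ((∑ κ, ∑ κ', φ κ * M κ κ' * φ κ' : ℝ) : ℂ) := by
  rw [← star_toSpinVec_dotProduct, ← toSpin_mulVec, LinearEquiv.apply_symm_apply, hM]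
  simp only [dotProduct, mulVec, Pi.star_apply, Matrix.of_apply, Complex.star_def, Complex.conj_ofReal,
    Complex.ofReal_sum, Complex.ofReal_mul, Finset.mul_sum]
  refine Finset.sum_congr rfl fun κ _ => Finset.sum_congr rfl fun κ' _ => by ring

/-- `#α` of the occupied set of a configuration, counted site by site: the number of sites whose local state
(`|0⟩, |α⟩, |β⟩, |αβ⟩`) contains an `α` electron. -/
theorem card_upPart_config (κ : TensorIndex Λ 4) :
    (upPart (config κ)).card = ∑ x, if (0 : Fin 2) ∈ siteOcc (κ x) then 1 else 0 := by
  have h : upPart (config κ) = univ.filter fun x => (0 : Fin 2) ∈ siteOcc (κ x) := by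
    ext x
    simp only [mem_upPart, orb_mem_config, mem_filter, mem_univ, true_and]
  rw [h, Finset.card_filter]

/-- `#β` of the occupied set of a configuration, counted site by site. -/
theorem card_downPart_config (κ : TensorIndex Λ 4) :
    (downPart (config κ)).card = ∑ x, if (1 : Fin 2) ∈ siteOcc (κ x) then 1 else 0 := by
  have h : downPart (config κ) = univ.filter fun x => (1 : Fin 2) ∈ siteOcc (κ x) := by
    ext x
    simp only [mem_downPart, orb_mem_config, mem_filter, mem_univ, true_and]
  rw [h, Finset.card_filter]

/-- **Sector.** If the real amplitude `φ κ` vanishes unless the configuration has `a` up and `b` down electrons,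
the Fock vector it defines lies in the `(a, b)` sector (`IsInSector`, what an upper certificate's vector must satisfy). -/
theorem isInSector_toSpinVec_symm_ofReal {a b : ℕ} (φ : TensorIndex Λ 4 → ℝ)
    (hφ : ∀ κ, φ κ ≠ 0 → (upPart (config κ)).card = a ∧ (downPart (config κ)).card = b) :
    IsInSector a b (toSpinVec.symm fun κ => (φ κ : ℂ)) := by
  intro S hS
  simp only [toSpinVec_symm_apply, Complex.ofReal_eq_zero]
  by_contra h
  exact hS (by simpa only [config_siteConfig] using hφ (siteConfig S) h)

end RealAmplitude

/-! ## Matrix-product states: the two sweeps are the Rayleigh data of the Fock vector -/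

section MPS

variable {k : ℕ} {n m : Type*} [Fintype n] [DecidableEq n] [Fintype m] [DecidableEq m]

/-- **The `⟨ψ|ψ⟩` sweep is the norm of the MPS vector (FORMAT-qcmps0 §1.2 + §4).** Site tensors `A i s` (square blocks
over one bond index type `n` — the file's block-sparse blocks zero-padded, as in `Rows/SweepContraction.lean`), boundary
vectors `u`, `w` (`D₀ = D_k = 1`: `u = w = e₀`), amplitude `ψ(κ) = u ⬝ (A_0^{κ₀} ⋯ A_{k-1}^{κ_{k-1}}) w` read as a Fock vector
through `toSpinVec`; the trivial-MPO recursion `G_{j+1} = Σ_s (A_j^s)ᵀ G_j A_j^s`, `G_0 = u uᵀ` gives `⟨ψ, ψ⟩ = w ⬝ G_k w`. -/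
theorem star_dotProduct_self_eq_gram_sweep (A : ℕ → Fin 4 → Matrix n n ℝ) (u w : n → ℝ)
    (G : ℕ → Matrix n n ℝ) (hG : ∀ j, G (j + 1) = ∑ s, (A j s)ᵀ * G j * A j s) (hG0 : G 0 = vecMulVec u u) :
    star (toSpinVec.symm fun κ : TensorIndex (Fin k) 4 =>
        ((u ⬝ᵥ ((List.ofFn fun i : Fin k => A i (κ i)).prod *ᵥ w) : ℝ) : ℂ)) ⬝ᵥ
      (toSpinVec.symm fun κ : TensorIndex (Fin k) 4 =>
        ((u ⬝ᵥ ((List.ofFn fun i : Fin k => A i (κ i)).prod *ᵥ w) : ℝ) : ℂ)) =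
      ((w ⬝ᵥ (G k *ᵥ w) : ℝ) : ℂ) := by
  rw [star_dotProduct_toSpinVec_symm_ofReal, dotProduct_gram_sweep_mulVec_eq A A G hG u u hG0 k w w]

/-- **The `⟨ψ|H|ψ⟩` sweep is the energy expectation of the MPS vector (FORMAT-qcmps0 §3 + §4).** If the MPO with
real site tensors `O i s s'` (bond index type `m`, START state `x₀`, END state `y₀`) REPRESENTS `H` — its word
products are the configuration matrix elements of `H` in the product basis, `(toSpin H)_{κ κ'} =
(O_0[κ₀,κ'₀] ⋯ O_{k-1}[κ_{k-1},κ'_{k-1}])[x₀, y₀]` (§3: "the contraction is `Σ_t c_t ⊗_j w^t_j = H_F`") — then the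
recursion `L_{j+1}[y] = Σ_x Σ_{s s'} O_j[x,y][s,s'] • (A_j^s)ᵀ L_j[x] A_j^{s'}`, `L_0 = u uᵀ` on `x₀`, gives `⟨ψ, H ψ⟩ = w ⬝ L_k[y₀] w`. -/
theorem star_dotProduct_mulVec_eq_sweep (H : Matrix (Finset (Orb (Fin k))) (Finset (Orb (Fin k))) ℂ)
    (A : ℕ → Fin 4 → Matrix n n ℝ) (u w : n → ℝ) (O : ℕ → Fin 4 → Fin 4 → Matrix m m ℝ) (x₀ y₀ : m)
    (hO : toSpin H = Matrix.of fun κ κ' : TensorIndex (Fin k) 4 =>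
      (((List.ofFn fun i : Fin k => O i (κ i) (κ' i)).prod x₀ y₀ : ℝ) : ℂ))
    (L : ℕ → m → Matrix n n ℝ)
    (hL : ∀ j y, L (j + 1) y = ∑ x, ∑ s, ∑ s', O j s s' x y • ((A j s)ᵀ * L j x * A j s'))
    (hL0 : ∀ x, L 0 x = if x = x₀ then vecMulVec u u else 0) :
    star (toSpinVec.symm fun κ : TensorIndex (Fin k) 4 =>
        ((u ⬝ᵥ ((List.ofFn fun i : Fin k => A i (κ i)).prod *ᵥ w) : ℝ) : ℂ)) ⬝ᵥ
      H *ᵥ (toSpinVec.symm fun κ : TensorIndex (Fin k) 4 =>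
        ((u ⬝ᵥ ((List.ofFn fun i : Fin k => A i (κ i)).prod *ᵥ w) : ℝ) : ℂ)) =
      ((w ⬝ᵥ (L k y₀ *ᵥ w) : ℝ) : ℂ) := by
  rw [star_dotProduct_mulVec_toSpinVec_symm_ofReal H _ hO, dotProduct_sweep_mulVec_eq A A O L hL x₀ u u hL0 k y₀ w w]
  congr 1
  exact Finset.sum_congr rfl fun κ _ => Finset.sum_congr rfl fun κ' _ => by ring

/-- **Right-to-left by chain reversal (FORMAT-qcmps0 §4, `reverse_problem`).** The MIRRORED problem — site `j`
carrying the transposed tensors of site `k − 1 − j` (`A′_j^t = (A_{k-1-j}^t)ᵀ`, `O′_j[y,x][t,t′] = O_{k-1-j}[x,y][t′,t]`),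
the left boundary block `w wᵀ` placed on the END state `y₀`, closed at the START state `x₀` with `u` — swept
left-to-right by the same recursion computes the SAME configuration sum `Σ_{κκ'} O-word[x₀,y₀]·ψ(κ)ψ(κ')` as the
direct sweep (`dotProduct_sweep_mulVec_eq` on the mirrored families + `sum_rev_words_eq`) — the right-canonical case. -/
theorem dotProduct_revSweep_mulVec_eq (A : ℕ → Fin 4 → Matrix n n ℝ) (u w : n → ℝ)
    (O : ℕ → Fin 4 → Fin 4 → Matrix m m ℝ) (x₀ y₀ : m) (L' : ℕ → m → Matrix n n ℝ)
    (hL' : ∀ j x, L' (j + 1) x = ∑ y, ∑ t, ∑ t',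
      (O (k - (j + 1)) t' t)ᵀ y x • (A (k - (j + 1)) t * L' j y * (A (k - (j + 1)) t')ᵀ))
    (hL'0 : ∀ y, L' 0 y = if y = y₀ then vecMulVec w w else 0) :
    u ⬝ᵥ (L' k x₀ *ᵥ u) = ∑ κ : TensorIndex (Fin k) 4, ∑ κ' : TensorIndex (Fin k) 4,
      (List.ofFn fun i : Fin k => O i (κ i) (κ' i)).prod x₀ y₀ *
        ((u ⬝ᵥ ((List.ofFn fun i : Fin k => A i (κ i)).prod *ᵥ w)) *
          (u ⬝ᵥ ((List.ofFn fun i : Fin k => A i (κ' i)).prod *ᵥ w))) := by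
  have h := dotProduct_sweep_mulVec_eq (fun j t => (A (k - (j + 1)) t)ᵀ) (fun j t => (A (k - (j + 1)) t)ᵀ)
    (fun j t t' => (O (k - (j + 1)) t' t)ᵀ) L'
    (fun j x => by rw [hL' j x]; simp only [Matrix.transpose_transpose]) y₀ w w hL'0 k x₀ u u
  have h2 := sum_rev_words_eq k A A O x₀ y₀ u u w w
  simp only [Fin.val_rev] at h2
  rw [h, ← h2]

/-- **From the path sum to the word products (FORMAT-qcmps0 §3 ⇒ the hypothesis `hO`).** If `H`, read in the product
basis, is the sum over the bond-state paths from `x₀` (START) to `y₀` (END) of the product operators of REAL edge letters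
`W i x y` — the form in which an automaton whose accepting paths enumerate a term list represents `Σ_t c_t ⨂_j w^t_j`
(`Rows/JordanWignerWords.lean`: `of_ofFn_prod_apply_eq_sum_paths_productOp`, and `toSpin_molecularHamiltonian_eq_sum_productOp`
for the term list of `H_F`) — then its configuration matrix elements are the word products of the site tensors
`O i s s' = (x, y) ↦ W i x y s s'`: the hypothesis `hO` of this file, with real entries. -/
theorem toSpin_eq_of_wordProducts_of_eq_sum_paths (H : Matrix (Finset (Orb (Fin k))) (Finset (Orb (Fin k))) ℂ)
    (W : ℕ → m → m → Matrix (Fin 4) (Fin 4) ℝ) (x₀ y₀ : m)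
    (hH : toSpin H = ∑ π : Fin (k + 1) → m, if π 0 = x₀ ∧ π (Fin.last k) = y₀ then
      productOp (fun i : Fin k => (W i (π (Fin.castSucc i)) (π i.succ)).map ((↑) : ℝ → ℂ)) else 0) :
    toSpin H = Matrix.of fun κ κ' : TensorIndex (Fin k) 4 =>
      (((List.ofFn fun i : Fin k => (Matrix.of fun x y : m => W i x y (κ i) (κ' i))).prod x₀ y₀ : ℝ) : ℂ) := by
  rw [hH, ← of_ofFn_prod_apply_eq_sum_paths_productOp (fun (i : Fin k) x y => (W i x y).map ((↑) : ℝ → ℂ)) x₀ y₀]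
  ext κ κ'
  rw [Matrix.of_apply, Matrix.of_apply]
  have hmap : (List.ofFn fun i : Fin k => (Matrix.of fun x y : m => (W i x y).map ((↑) : ℝ → ℂ) (κ i) (κ' i))) =
      (List.ofFn fun i : Fin k => (Matrix.of fun x y : m => W i x y (κ i) (κ' i))).map
        (Complex.ofRealHom.mapMatrix : Matrix m m ℝ →+* Matrix m m ℂ) := by
    rw [List.map_ofFn]
    rfl
  rw [hmap, ← map_list_prod, RingHom.mapMatrix_apply, Matrix.map_apply, Complex.ofRealHom_eq_coe]

/-! ## The certificate: sector support + enclosures of the two sums + the value rule ⇒ `UpperCertificate` -/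

/-- The Rayleigh data of an MPS vector from enclosures of the two CONFIGURATION SUMS (direction-free form; the swept
numbers of either direction equal these sums). -/
private theorem rayleigh_of_mps_configSums (H : Matrix (Finset (Orb (Fin k))) (Finset (Orb (Fin k))) ℂ) {a b : ℕ}
    (A : ℕ → Fin 4 → Matrix n n ℝ) (u w : n → ℝ) (O : ℕ → Fin 4 → Fin 4 → Matrix m m ℝ) (x₀ y₀ : m)
    (hO : toSpin H = Matrix.of fun κ κ' : TensorIndex (Fin k) 4 =>
      (((List.ofFn fun i : Fin k => O i (κ i) (κ' i)).prod x₀ y₀ : ℝ) : ℂ))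
    (hsec : ∀ κ : TensorIndex (Fin k) 4, u ⬝ᵥ ((List.ofFn fun i : Fin k => A i (κ i)).prod *ᵥ w) ≠ 0 →
      (upPart (config κ)).card = a ∧ (downPart (config κ)).card = b)
    {hhi nlo nhi E : ℝ}
    (hh : ∑ κ : TensorIndex (Fin k) 4, ∑ κ' : TensorIndex (Fin k) 4,
      (List.ofFn fun i : Fin k => O i (κ i) (κ' i)).prod x₀ y₀ *
        ((u ⬝ᵥ ((List.ofFn fun i : Fin k => A i (κ i)).prod *ᵥ w)) *
          (u ⬝ᵥ ((List.ofFn fun i : Fin k => A i (κ' i)).prod *ᵥ w))) ≤ hhi)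
    (hlo : nlo ≤ ∑ κ : TensorIndex (Fin k) 4, (u ⬝ᵥ ((List.ofFn fun i : Fin k => A i (κ i)).prod *ᵥ w)) *
      (u ⬝ᵥ ((List.ofFn fun i : Fin k => A i (κ i)).prod *ᵥ w)))
    (hnhi : ∑ κ : TensorIndex (Fin k) 4, (u ⬝ᵥ ((List.ofFn fun i : Fin k => A i (κ i)).prod *ᵥ w)) *
      (u ⬝ᵥ ((List.ofFn fun i : Fin k => A i (κ i)).prod *ᵥ w)) ≤ nhi)
    (hpos : 0 < nlo) (hE : max (hhi / nlo) (hhi / nhi) ≤ E) :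
    IsInSector a b (toSpinVec.symm fun κ : TensorIndex (Fin k) 4 =>
        ((u ⬝ᵥ ((List.ofFn fun i : Fin k => A i (κ i)).prod *ᵥ w) : ℝ) : ℂ)) ∧
      (toSpinVec.symm fun κ : TensorIndex (Fin k) 4 =>
        ((u ⬝ᵥ ((List.ofFn fun i : Fin k => A i (κ i)).prod *ᵥ w) : ℝ) : ℂ)) ≠ 0 ∧
      (star (toSpinVec.symm fun κ : TensorIndex (Fin k) 4 =>
          ((u ⬝ᵥ ((List.ofFn fun i : Fin k => A i (κ i)).prod *ᵥ w) : ℝ) : ℂ)) ⬝ᵥ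
        H *ᵥ (toSpinVec.symm fun κ : TensorIndex (Fin k) 4 =>
          ((u ⬝ᵥ ((List.ofFn fun i : Fin k => A i (κ i)).prod *ᵥ w) : ℝ) : ℂ))).re ≤
      E * (star (toSpinVec.symm fun κ : TensorIndex (Fin k) 4 =>
          ((u ⬝ᵥ ((List.ofFn fun i : Fin k => A i (κ i)).prod *ᵥ w) : ℝ) : ℂ)) ⬝ᵥ
        (toSpinVec.symm fun κ : TensorIndex (Fin k) 4 =>
          ((u ⬝ᵥ ((List.ofFn fun i : Fin k => A i (κ i)).prod *ᵥ w) : ℝ) : ℂ))).re := by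
  have hn := star_dotProduct_toSpinVec_symm_ofReal (fun κ : TensorIndex (Fin k) 4 =>
    u ⬝ᵥ ((List.ofFn fun i : Fin k => A i (κ i)).prod *ᵥ w))
  have hHψ := star_dotProduct_mulVec_toSpinVec_symm_ofReal H _ hO (fun κ : TensorIndex (Fin k) 4 =>
    u ⬝ᵥ ((List.ofFn fun i : Fin k => A i (κ i)).prod *ᵥ w))
  have hnpos : 0 < ∑ κ : TensorIndex (Fin k) 4, (u ⬝ᵥ ((List.ofFn fun i : Fin k => A i (κ i)).prod *ᵥ w)) *
      (u ⬝ᵥ ((List.ofFn fun i : Fin k => A i (κ i)).prod *ᵥ w)) := hpos.trans_le hlo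
  refine ⟨isInSector_toSpinVec_symm_ofReal _ hsec, ?_, ?_⟩
  · intro h0
    rw [h0, dotProduct_zero] at hn
    exact hnpos.ne' (by exact_mod_cast hn.symm)
  · rw [hHψ, hn, Complex.ofReal_re, Complex.ofReal_re]
    refine (le_max_div_mul_of_enclosure ?_ hlo hnhi hpos).trans (mul_le_mul_of_nonneg_right hE hnpos.le)
    refine le_of_eq_of_le ?_ hh
    exact Finset.sum_congr rfl fun κ _ => Finset.sum_congr rfl fun κ' _ => by ring

/-- **Variational bound from an MPS, direction-free form.** For a Hermitian `H` represented by the MPO `O` in the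
product basis and an MPS (`A`, `u`, `w`) supported on the `(a, b)` sector: enclosures `Σ_{κκ'} O-word[x₀,y₀]·ψ(κ)ψ(κ') ≤ hhi`
and `0 < nlo ≤ Σ_κ ψ(κ)² ≤ nhi` of the two CONFIGURATION SUMS (the numbers both sweep directions compute:
`dotProduct_sweep_mulVec_eq`, `dotProduct_revSweep_mulVec_eq`) and `E ≥ max (hhi/nlo) (hhi/nhi)` give
`sectorGroundEnergy H a b ≤ E` (Rayleigh–Ritz in the sector, `sectorGroundEnergy_le_of_rayleigh`). -/
theorem sectorGroundEnergy_le_of_mps_configSums {H : Matrix (Finset (Orb (Fin k))) (Finset (Orb (Fin k))) ℂ}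
    (hH : H.IsHermitian) {a b : ℕ}
    (A : ℕ → Fin 4 → Matrix n n ℝ) (u w : n → ℝ) (O : ℕ → Fin 4 → Fin 4 → Matrix m m ℝ) (x₀ y₀ : m)
    (hO : toSpin H = Matrix.of fun κ κ' : TensorIndex (Fin k) 4 =>
      (((List.ofFn fun i : Fin k => O i (κ i) (κ' i)).prod x₀ y₀ : ℝ) : ℂ))
    (hsec : ∀ κ : TensorIndex (Fin k) 4, u ⬝ᵥ ((List.ofFn fun i : Fin k => A i (κ i)).prod *ᵥ w) ≠ 0 →
      (upPart (config κ)).card = a ∧ (downPart (config κ)).card = b)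
    {hhi nlo nhi E : ℝ}
    (hh : ∑ κ : TensorIndex (Fin k) 4, ∑ κ' : TensorIndex (Fin k) 4,
      (List.ofFn fun i : Fin k => O i (κ i) (κ' i)).prod x₀ y₀ *
        ((u ⬝ᵥ ((List.ofFn fun i : Fin k => A i (κ i)).prod *ᵥ w)) *
          (u ⬝ᵥ ((List.ofFn fun i : Fin k => A i (κ' i)).prod *ᵥ w))) ≤ hhi)
    (hlo : nlo ≤ ∑ κ : TensorIndex (Fin k) 4, (u ⬝ᵥ ((List.ofFn fun i : Fin k => A i (κ i)).prod *ᵥ w)) *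
      (u ⬝ᵥ ((List.ofFn fun i : Fin k => A i (κ i)).prod *ᵥ w)))
    (hnhi : ∑ κ : TensorIndex (Fin k) 4, (u ⬝ᵥ ((List.ofFn fun i : Fin k => A i (κ i)).prod *ᵥ w)) *
      (u ⬝ᵥ ((List.ofFn fun i : Fin k => A i (κ i)).prod *ᵥ w)) ≤ nhi)
    (hpos : 0 < nlo) (hE : max (hhi / nlo) (hhi / nhi) ≤ E) :
    sectorGroundEnergy H a b ≤ E := by
  obtain ⟨hψ, h0, hu⟩ := rayleigh_of_mps_configSums H A u w O x₀ y₀ hO hsec hh hlo hnhi hpos hE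
  exact sectorGroundEnergy_le_of_rayleigh hH hψ h0 hu

/-- **The cell's MPS upper certificate, direction-free form (FORMAT-qcmps0 §0): `UpperCertificate F a b hi`.** For a
model `F : Model k`: an MPS (`A`, `u`, `w`) supported on the `(a, b)` sector, an MPO `O` representing `H_F` in the
product basis, enclosures `hhi`, `nlo`, `nhi` of the two configuration sums with `0 < nlo`, and an issued rational
`hi ≥ max (hhi/nlo) (hhi/nhi)` (the value rule) give the typer's `UpperCertificate F a b hi` — the MPS vector is the
witness. No symmetry of `F` is needed for the certificate predicate itself. -/
theorem upperCertificate_of_mps_configSums (F : Model k) {a b : ℕ}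
    (A : ℕ → Fin 4 → Matrix n n ℝ) (u w : n → ℝ) (O : ℕ → Fin 4 → Fin 4 → Matrix m m ℝ) (x₀ y₀ : m)
    (hO : toSpin F.hamiltonian = Matrix.of fun κ κ' : TensorIndex (Fin k) 4 =>
      (((List.ofFn fun i : Fin k => O i (κ i) (κ' i)).prod x₀ y₀ : ℝ) : ℂ))
    (hsec : ∀ κ : TensorIndex (Fin k) 4, u ⬝ᵥ ((List.ofFn fun i : Fin k => A i (κ i)).prod *ᵥ w) ≠ 0 →
      (upPart (config κ)).card = a ∧ (downPart (config κ)).card = b)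
    {hhi nlo nhi : ℝ}
    (hh : ∑ κ : TensorIndex (Fin k) 4, ∑ κ' : TensorIndex (Fin k) 4,
      (List.ofFn fun i : Fin k => O i (κ i) (κ' i)).prod x₀ y₀ *
        ((u ⬝ᵥ ((List.ofFn fun i : Fin k => A i (κ i)).prod *ᵥ w)) *
          (u ⬝ᵥ ((List.ofFn fun i : Fin k => A i (κ' i)).prod *ᵥ w))) ≤ hhi)
    (hlo : nlo ≤ ∑ κ : TensorIndex (Fin k) 4, (u ⬝ᵥ ((List.ofFn fun i : Fin k => A i (κ i)).prod *ᵥ w)) *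
      (u ⬝ᵥ ((List.ofFn fun i : Fin k => A i (κ i)).prod *ᵥ w)))
    (hnhi : ∑ κ : TensorIndex (Fin k) 4, (u ⬝ᵥ ((List.ofFn fun i : Fin k => A i (κ i)).prod *ᵥ w)) *
      (u ⬝ᵥ ((List.ofFn fun i : Fin k => A i (κ i)).prod *ᵥ w)) ≤ nhi)
    (hpos : 0 < nlo) {hi : ℚ} (hE : max (hhi / nlo) (hhi / nhi) ≤ ((hi : ℚ) : ℝ)) :
    UpperCertificate F a b hi := by
  obtain ⟨hψ, h0, hu⟩ := rayleigh_of_mps_configSums F.hamiltonian A u w O x₀ y₀ hO hsec hh hlo hnhi hpos hE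
  exact ⟨_, hψ, h0, hu⟩

/-- **The cell's MPS upper certificate from the left-to-right sweeps (FORMAT-qcmps0 §4, "Recursion").** As
`upperCertificate_of_mps_configSums`, with the enclosures stated for the swept numbers `w ⬝ L_k[y₀] w` (environment
recursion with the MPO) and `w ⬝ G_k w` (trivial-MPO recursion) of the EXACT recursions — the quantities the arithmetic
lineages enclose (`Rows/SweepErrorBudget.lean`: `|L̂ − L| ≤ e`). For a right-to-left certificate rewrite the
enclosure of `⟨ψ|H|ψ⟩` with `dotProduct_revSweep_mulVec_eq` and use the direction-free form. -/
theorem upperCertificate_of_mps_sweeps (F : Model k) {a b : ℕ}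
    (A : ℕ → Fin 4 → Matrix n n ℝ) (u w : n → ℝ) (O : ℕ → Fin 4 → Fin 4 → Matrix m m ℝ) (x₀ y₀ : m)
    (hO : toSpin F.hamiltonian = Matrix.of fun κ κ' : TensorIndex (Fin k) 4 =>
      (((List.ofFn fun i : Fin k => O i (κ i) (κ' i)).prod x₀ y₀ : ℝ) : ℂ))
    (hsec : ∀ κ : TensorIndex (Fin k) 4, u ⬝ᵥ ((List.ofFn fun i : Fin k => A i (κ i)).prod *ᵥ w) ≠ 0 →
      (upPart (config κ)).card = a ∧ (downPart (config κ)).card = b)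
    (L : ℕ → m → Matrix n n ℝ)
    (hL : ∀ j y, L (j + 1) y = ∑ x, ∑ s, ∑ s', O j s s' x y • ((A j s)ᵀ * L j x * A j s'))
    (hL0 : ∀ x, L 0 x = if x = x₀ then vecMulVec u u else 0)
    (G : ℕ → Matrix n n ℝ) (hG : ∀ j, G (j + 1) = ∑ s, (A j s)ᵀ * G j * A j s) (hG0 : G 0 = vecMulVec u u)
    {hhi nlo nhi : ℝ} (hh : w ⬝ᵥ (L k y₀ *ᵥ w) ≤ hhi) (hlo : nlo ≤ w ⬝ᵥ (G k *ᵥ w))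
    (hnhi : w ⬝ᵥ (G k *ᵥ w) ≤ nhi) (hpos : 0 < nlo) {hi : ℚ} (hE : max (hhi / nlo) (hhi / nhi) ≤ ((hi : ℚ) : ℝ)) :
    UpperCertificate F a b hi := by
  rw [dotProduct_sweep_mulVec_eq A A O L hL x₀ u u hL0 k y₀ w w] at hh
  rw [dotProduct_gram_sweep_mulVec_eq A A G hG u u hG0 k w w] at hlo hnhi
  exact upperCertificate_of_mps_configSums F A u w O x₀ y₀ hO hsec hh hlo hnhi hpos hE

/-! ### The §1.2 sector rule delivers the support hypothesis -/

/-- **Charge labels ⇒ sector support (FORMAT-qcmps0 §1.2, "SECTOR RULE").** If every bond state carries an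
`(n_α, n_β)` label `c b x`, every non-zero block entry raises the label by the site's occupation
(`A_i^s[x,y] ≠ 0 → c_{i+1}(y) = c_i(x) + occ(s)`, `occ = (0,0),(1,0),(0,1),(1,1)` for `|0⟩,|α⟩,|β⟩,|αβ⟩`), the left
boundary vector lives on label `(0,0)` and the right one on `(a, b)` (bond `0 = {(0,0)}`, bond `k = {(na,nb)}`), then the
amplitude `u ⬝ (A-word κ) w` vanishes off the configurations with `a` up and `b` down electrons — the hypothesis `hsec`
of the theorems above, by induction over sites (`ofFn_prod_apply_eq_zero_of_charge_ne`), no numerics involved. -/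
theorem mps_support_of_charges (A : ℕ → Fin 4 → Matrix n n ℝ) (u w : n → ℝ) {a b : ℕ}
    (c : Fin (k + 1) → n → ℕ × ℕ)
    (hA : ∀ (i : Fin k) (s : Fin 4) (x y : n), A i s x y ≠ 0 → c i.succ y = c (Fin.castSucc i) x +
      (if (0 : Fin 2) ∈ siteOcc s then 1 else 0, if (1 : Fin 2) ∈ siteOcc s then 1 else 0))
    (hu : ∀ x, u x ≠ 0 → c 0 x = (0, 0)) (hw : ∀ y, w y ≠ 0 → c (Fin.last k) y = (a, b)) :
    ∀ κ : TensorIndex (Fin k) 4, u ⬝ᵥ ((List.ofFn fun i : Fin k => A i (κ i)).prod *ᵥ w) ≠ 0 →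
      (upPart (config κ)).card = a ∧ (downPart (config κ)).card = b := by
  intro κ hκ
  obtain ⟨x, -, hx⟩ := Finset.exists_ne_zero_of_sum_ne_zero hκ
  have hux : u x ≠ 0 := left_ne_zero_of_mul hx
  obtain ⟨y, -, hy⟩ := Finset.exists_ne_zero_of_sum_ne_zero (right_ne_zero_of_mul hx)
  have hWxy : (List.ofFn fun i : Fin k => A i (κ i)).prod x y ≠ 0 := left_ne_zero_of_mul hy
  have hwy : w y ≠ 0 := right_ne_zero_of_mul hy
  have hcharge : c (Fin.last k) y = c 0 x +
      ∑ i : Fin k, (if (0 : Fin 2) ∈ siteOcc (κ i) then 1 else 0, if (1 : Fin 2) ∈ siteOcc (κ i) then 1 else 0) := by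
    by_contra hne
    exact hWxy (ofFn_prod_apply_eq_zero_of_charge_ne (fun i : Fin k => A i (κ i)) c
      (fun i => (if (0 : Fin 2) ∈ siteOcc (κ i) then 1 else 0, if (1 : Fin 2) ∈ siteOcc (κ i) then 1 else 0))
      (fun i x' y' h => hA i (κ i) x' y' h) hne)
  rw [hu x hux, hw y hwy, Prod.ext_iff] at hcharge
  simp only [Prod.fst_add, Prod.snd_add, Prod.fst_sum, Prod.snd_sum, zero_add] at hcharge
  exact ⟨by rw [card_upPart_config, hcharge.1], by rw [card_downPart_config, hcharge.2]⟩

/-- **END FORM — the MPS level's kernel chain (FORMAT-qcmps0 §0–§4 composed).** For a symmetric model `F`: an MPS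
state file passing the §1.2 sector checks (charge-labelled blocks, bond `0 = {(0,0)}`, bond `k = {(a,b)}`), the exact
MPO representing `H_F` (§3), the two exact sweeps (§4) and their enclosures with the value rule (§4 BOUND) prove the
row `UpperRow F a b hi`. Which instance facts remain outside the kernel for the cell's files: the block entries and
labels themselves (the `.npz` of §1, `> 2·10⁴` literals), the MPO's accepting-paths bookkeeping (`hO`, §3;
structurally `Rows/JordanWignerWords.lean`), and the arithmetic of the enclosures (`hh`, `hlo`, `hnhi`: the readers'
interval / norm-budget evaluations, `Rows/SweepErrorBudget.lean`). -/
theorem upperRow_of_mps_charges_sweeps {F : Model k} (hF : F.IsSymmetric) {a b : ℕ}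
    (A : ℕ → Fin 4 → Matrix n n ℝ) (u w : n → ℝ) (c : Fin (k + 1) → n → ℕ × ℕ)
    (hA : ∀ (i : Fin k) (s : Fin 4) (x y : n), A i s x y ≠ 0 → c i.succ y = c (Fin.castSucc i) x +
      (if (0 : Fin 2) ∈ siteOcc s then 1 else 0, if (1 : Fin 2) ∈ siteOcc s then 1 else 0))
    (hu : ∀ x, u x ≠ 0 → c 0 x = (0, 0)) (hw : ∀ y, w y ≠ 0 → c (Fin.last k) y = (a, b))
    (O : ℕ → Fin 4 → Fin 4 → Matrix m m ℝ) (x₀ y₀ : m)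
    (hO : toSpin F.hamiltonian = Matrix.of fun κ κ' : TensorIndex (Fin k) 4 =>
      (((List.ofFn fun i : Fin k => O i (κ i) (κ' i)).prod x₀ y₀ : ℝ) : ℂ))
    (L : ℕ → m → Matrix n n ℝ)
    (hL : ∀ j y, L (j + 1) y = ∑ x, ∑ s, ∑ s', O j s s' x y • ((A j s)ᵀ * L j x * A j s'))
    (hL0 : ∀ x, L 0 x = if x = x₀ then vecMulVec u u else 0)
    (G : ℕ → Matrix n n ℝ) (hG : ∀ j, G (j + 1) = ∑ s, (A j s)ᵀ * G j * A j s) (hG0 : G 0 = vecMulVec u u)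
    {hhi nlo nhi : ℝ} (hh : w ⬝ᵥ (L k y₀ *ᵥ w) ≤ hhi) (hlo : nlo ≤ w ⬝ᵥ (G k *ᵥ w))
    (hnhi : w ⬝ᵥ (G k *ᵥ w) ≤ nhi) (hpos : 0 < nlo) {hi : ℚ} (hE : max (hhi / nlo) (hhi / nhi) ≤ ((hi : ℚ) : ℝ)) :
    UpperRow F a b hi :=
  upperRow_of_certificate hF (upperCertificate_of_mps_sweeps F A u w O x₀ y₀ hO
    (mps_support_of_charges A u w c hA hu hw) L hL hL0 G hG hG0 hh hlo hnhi hpos hE)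

end MPS

end Summit.Ventures.CertifiedQuantumChemistry

end
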